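import Summits.RiemannHypothesis.RiemannHypothesis.Theorems.SoloInformedOnset
import Literature.NumberTheory.LFunctions.WeilGroundState
import Literature.NumberTheory.LFunctions.WeilGroundStateRealZerosProofs
import Literature.NumberTheory.LFunctions.WeilWindowSimpleEven
import Literature.NumberTheory.LFunctions.WeilExplicitProofs
import Summits.RiemannHypothesis.RiemannHypothesis.Theorems.WeilGroundStateGroundStatesConvergeToXiEulerLagrange
import HarnessLib

/-!
# The weak Euler–Lagrange equation of an operator-free ground state (Bombieri 2000, (4.2))

Solo programme `solo-RiemannHypothesis-informed`, session 25.  Everything here is proved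
unconditionally; no operator, no compactness and no existence statement is used.

Fix a window `[-a, a]`, `a > 0`, and let `ε(a) = weilGroundEnergy a` be the infimum of `Re Q` over the
unit `L²`-sphere of test functions supported in the window.  Let `gₙ` be ANY normalised minimising
sequence of window tests (`Re Q(gₙ) → ε(a)`, `‖gₙ‖₂ = 1`) converging in `L²` to some `u`
(this is exactly the data of `IsWeilGroundState a u`, `Literature/…/WeilGroundState.lean`).  Then for
every test `h` supported in `[-a, a]` the cross terms of Weil's functional converge and

  `W(gₙ ⋆ h̃) ⟶ ε(a) · ⟨u, h⟩`,   `⟨u, h⟩ = ∫ u · conj h`        (`tendsto_weilCross_of_minimizing`).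

This is the weak (distributional) form of Bombieri's variational equation
`P_Ω D(f₁ ⋆ x^{-1} ⋆ φ*) = λ φ` (Bombieri 2000, Lemma 1 and (4.2)) in the operator-free `L²`
encoding of the tree: the limit `u` is a weak eigenvector of the truncated Weil form with eigenvalue
`ε(a)`.  The proof is the first variation of `Re Q(gₙ + t h) ≥ ε(a) ‖gₙ + t h‖₂²` (`t ∈ ℝ`, then `h ↦ i h`):
the discriminant of the resulting quadratic polynomial in `t` forces
`|Re W(gₙ ⋆ h̃) - ε(a) Re⟨gₙ, h⟩|² ≤ (Re Q(h) - ε(a)‖h‖²) · (Re Q(gₙ) - ε(a)) → 0`, using the hermitian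
symmetry `W(h ⋆ g̃) = conj W(g ⋆ h̃)` (the tree's `GroundStatesConvergeToXi.weilFunctional_weilConv_weilReflect_swap`,
hypothesis-free).

Consequences.  At an ONSET `a₀` of negativity of `ε` (`IsWeilOnset a₀`, so `ε(a₀) = 0`; such an
`a₀` exists as soon as the Riemann hypothesis fails, `exists_isWeilOnset_of_not_riemannHypothesis`)
every ground state is a WEAK NULL VECTOR of Weil's form on the window: `W(gₙ ⋆ h̃) → 0` for every
window test `h` (`tendsto_weilCross_zero_of_onset`).  Hence (`riemannHypothesis_of_groundStates_not_null`):
if ground states exist on every window `a ≥ log 3 / 2` (Bombieri 2000, Thm. 3, not formalised; an explicit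
hypothesis, or the compactness claim `ConnesConsaniMoscovici2025_thm_3_6`) and no ground state of such a
window is a weak null vector, the Riemann hypothesis holds.

References: E. Bombieri, *Remarks on Weil's quadratic functional in the theory of prime numbers, I*,
Atti Accad. Naz. Lincei Rend. Lincei (9) 11 (2000) 183–233, §4 (Problem 2, Lemma 1, (4.2), Thm. 3)
[Bombieri2000Weil]; A. Connes, C. Consani, H. Moscovici, *Zeta zeros and prolate wave operators*
(2024–2026) for the semilocal ground state [ConnesConsaniMoscovici2024].
-/

noncomputable section

open Complex Filter Set Topology MeasureTheory
open Literature.NumberTheory.LFunctions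
open Literature.NumberTheory.LFunctions.ConnesVanSuijlekom
open Summit.RiemannHypothesis.RiemannHypothesis.Theorems.GroundStatesConvergeToXi
  (conj_weilFunctional_eq_weilReflect weilReflect_weilConv_weilReflect weilFunctional_weilConv_weilReflect_swap)
open scoped ComplexConjugate

namespace Summit.RiemannHypothesis.RiemannHypothesis.Theorems

variable {a : ℝ} {f g h k u : ℝ → ℂ}

/-! ## Hermitian symmetry of the cross terms (hypothesis-free)

The identities `conj W(k) = W(k̃)`, `(g ⋆ h̃)̃ = h ⋆ g̃` and `W(h ⋆ g̃) = conj W(g ⋆ h̃)` are already in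
the tree (module `…Theorems.WeilGroundStateGroundStatesConvergeToXiEulerLagrange`, namespace
`GroundStatesConvergeToXi`: `conj_weilFunctional_eq_weilReflect`, `weilReflect_weilConv_weilReflect`,
`weilFunctional_weilConv_weilReflect_swap`); they are used by name. -/

/-- `Re (W(g ⋆ h̃) + W(h ⋆ g̃)) = 2 Re W(g ⋆ h̃)`. [new] -/
theorem re_weilCross_add_swap (g h : ℝ → ℂ) :
    (weilFunctional (weilConv g (weilReflect h)) + weilFunctional (weilConv h (weilReflect g))).re =
      2 * (weilFunctional (weilConv g (weilReflect h))).re := by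
  rw [weilFunctional_weilConv_weilReflect_swap, Complex.add_re, Complex.conj_re]
  ring

/-! ## Bookkeeping: the direction `i h`, inner products -/

/-- `W(g ⋆ (c h)̃) = conj c · W(g ⋆ h̃)`. [new] -/
theorem weilCross_const_mul_right (c : ℂ) (g h : ℝ → ℂ) :
    weilFunctional (weilConv g (weilReflect fun t ↦ c * h t)) =
      conj c * weilFunctional (weilConv g (weilReflect h)) := by
  rw [weilReflect_const_mul, weilConv_const_mul_right, weilFunctional_const_mul]

/-- `∫ g · conj (c h) = conj c · ∫ g · conj h`. [new] -/
theorem integral_mul_conj_const_mul (c : ℂ) (g h : ℝ → ℂ) :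
    ∫ t, g t * conj (c * h t) = conj c * ∫ t, g t * conj (h t) := by
  rw [← integral_const_mul]
  congr 1 with t
  simp only [map_mul]
  ring

/-- `Re (conj i · z) = Im z`. [new] -/
theorem re_conj_I_mul (z : ℂ) : (conj I * z).re = z.im := by
  simp [Complex.conj_I]

/-- `∫ g · conj h = conj ∫ h · conj g`. [new] -/
theorem integral_mul_conj_comm (g h : ℝ → ℂ) :
    ∫ t, g t * conj (h t) = conj (∫ t, h t * conj (g t)) := by
  rw [← integral_conj]
  congr 1 with t
  simp only [map_mul, Complex.conj_conj]
  ring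

/-- Support of `gₙ + t h` stays in the window. [new] -/
theorem tsupport_add_const_mul_subset (t : ℂ) (hgs : tsupport g ⊆ Icc (-a) a)
    (hhs : tsupport h ⊆ Icc (-a) a) :
    tsupport (g + fun x ↦ t * h x) ⊆ Icc (-a) a :=
  (tsupport_add _ _).trans (union_subset hgs ((tsupport_mul_subset_right).trans hhs))

/-! ## The first variation -/

/-- **Discriminant step.** For a window test `g` and a window test `h`,
`(Re W(g ⋆ h̃) - ε(a) Re⟨g, h⟩)² ≤ (Re Q(h) - ε(a)‖h‖₂²) · (Re Q(g) - ε(a)‖g‖₂²)`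
(first variation of `Re Q ≥ ε(a)‖·‖₂²` along the real line `g + t h`). [new] -/
theorem sq_re_weilCross_sub_le (hg : IsWeilTest g) (hgs : tsupport g ⊆ Icc (-a) a)
    (hh : IsWeilTest h) (hhs : tsupport h ⊆ Icc (-a) a) :
    ((weilFunctional (weilConv g (weilReflect h))).re -
        weilGroundEnergy a * (∫ t, g t * conj (h t)).re) ^ 2 ≤
      ((weilQuadratic h).re - weilGroundEnergy a * ∫ t, ‖h t‖ ^ 2) *
        ((weilQuadratic g).re - weilGroundEnergy a * ∫ t, ‖g t‖ ^ 2) := by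
  set ε := weilGroundEnergy a with hε
  set x := (weilFunctional (weilConv g (weilReflect h))).re - ε * (∫ t, g t * conj (h t)).re with hx
  set K := (weilQuadratic h).re - ε * ∫ t, ‖h t‖ ^ 2 with hK
  set D := (weilQuadratic g).re - ε * ∫ t, ‖g t‖ ^ 2 with hD
  -- the quadratic polynomial `K t² + 2 x t + D` is nonnegative on `ℝ`
  have hpoly : ∀ t : ℝ, 0 ≤ K * (t * t) + 2 * x * t + D := by
    intro t
    have hF : IsWeilTest (g + fun y ↦ (t : ℂ) * h y) := hg.add (hh.const_mul t)
    have hFs : tsupport (g + fun y ↦ (t : ℂ) * h y) ⊆ Icc (-a) a :=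
      tsupport_add_const_mul_subset t hgs hhs
    have hineq := weilGroundEnergy_mul_le_re hF hFs
    rw [re_weilQuadratic_add_real_mul hg hh t, integral_norm_sq_add_real_mul hg hh t,
      re_weilCross_add_swap] at hineq
    rw [hK, hx, hD]
    nlinarith [hineq]
  have hdisc := discrim_le_zero hpoly
  rw [discrim] at hdisc
  nlinarith [hdisc]

/-- The defect `Re Q(h) - ε(a)‖h‖₂²` of a window test is nonnegative. [new] -/
theorem weilDefect_nonneg (hh : IsWeilTest h) (hhs : tsupport h ⊆ Icc (-a) a) :
    0 ≤ (weilQuadratic h).re - weilGroundEnergy a * ∫ t, ‖h t‖ ^ 2 :=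
  sub_nonneg.2 (weilGroundEnergy_mul_le_re hh hhs)

/-- **Real part of the weak Euler–Lagrange equation along a minimising sequence.**  If `gₙ` are
window tests with `‖gₙ‖₂ = 1` and `Re Q(gₙ) → ε(a)`, then for every window test `h`,
`Re W(gₙ ⋆ h̃) - ε(a) Re⟨gₙ, h⟩ → 0`. [new] -/
theorem tendsto_re_weilCross_sub (g : ℕ → ℝ → ℂ) (hg : ∀ n, IsWeilTest (g n))
    (hgs : ∀ n, tsupport (g n) ⊆ Icc (-a) a) (hg1 : ∀ n, ∫ t, ‖g n t‖ ^ 2 = (1 : ℝ))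
    (hQ : Tendsto (fun n ↦ (weilQuadratic (g n)).re) atTop (𝓝 (weilGroundEnergy a)))
    (hh : IsWeilTest h) (hhs : tsupport h ⊆ Icc (-a) a) :
    Tendsto (fun n ↦ (weilFunctional (weilConv (g n) (weilReflect h))).re -
        weilGroundEnergy a * (∫ t, g n t * conj (h t)).re) atTop (𝓝 0) := by
  set ε := weilGroundEnergy a with hε
  set K := (weilQuadratic h).re - ε * ∫ t, ‖h t‖ ^ 2 with hK
  have hK0 : 0 ≤ K := weilDefect_nonneg hh hhs
  -- the defects `Dₙ = Re Q(gₙ) - ε → 0`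
  have hD : Tendsto (fun n ↦ (weilQuadratic (g n)).re - ε * ∫ t, ‖g n t‖ ^ 2) atTop (𝓝 0) := by
    have : Tendsto (fun n ↦ (weilQuadratic (g n)).re - ε) atTop (𝓝 (ε - ε)) :=
      hQ.sub tendsto_const_nhds
    rw [sub_self] at this
    refine this.congr' (Eventually.of_forall fun n ↦ ?_)
    simp [hg1 n]
  -- squeeze with `|xₙ| ≤ √(K · Dₙ)`
  have hbound : ∀ n, |(weilFunctional (weilConv (g n) (weilReflect h))).re -
      ε * (∫ t, g n t * conj (h t)).re| ≤
        Real.sqrt (K * ((weilQuadratic (g n)).re - ε * ∫ t, ‖g n t‖ ^ 2)) := by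
    intro n
    have h2 := sq_re_weilCross_sub_le (hg n) (hgs n) hh hhs
    rw [← Real.sqrt_sq_eq_abs]
    exact Real.sqrt_le_sqrt h2
  have hsqrt : Tendsto (fun n ↦ Real.sqrt (K * ((weilQuadratic (g n)).re - ε * ∫ t, ‖g n t‖ ^ 2)))
      atTop (𝓝 0) := by
    have := (hD.const_mul K).sqrt
    simpa using this
  exact squeeze_zero_norm (fun n ↦ by simpa [Real.norm_eq_abs] using hbound n) hsqrt

/-- **The weak Euler–Lagrange equation along a minimising sequence (Bombieri 2000, (4.2),
operator-free form).**  Let `gₙ` be normalised window tests with `Re Q(gₙ) → ε(a)` converging in `L²`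
to `u`.  Then for every test `h` supported in `[-a, a]`,
`W(gₙ ⋆ h̃) → ε(a) · ∫ u · conj h`. [new] -/
theorem tendsto_weilCross_of_minimizing (g : ℕ → ℝ → ℂ) (hg : ∀ n, IsWeilTest (g n))
    (hgs : ∀ n, tsupport (g n) ⊆ Icc (-a) a) (hg1 : ∀ n, ∫ t, ‖g n t‖ ^ 2 = (1 : ℝ))
    (hQ : Tendsto (fun n ↦ (weilQuadratic (g n)).re) atTop (𝓝 (weilGroundEnergy a)))
    (hu : MemLp u 2) (hgu : Tendsto (fun n ↦ ∫ t, ‖g n t - u t‖ ^ 2) atTop (𝓝 0))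
    (hh : IsWeilTest h) (hhs : tsupport h ⊆ Icc (-a) a) :
    Tendsto (fun n ↦ weilFunctional (weilConv (g n) (weilReflect h))) atTop
      (𝓝 ((weilGroundEnergy a : ℂ) * ∫ t, u t * conj (h t))) := by
  -- abbreviations
  set c : ℕ → ℂ := fun n ↦ weilFunctional (weilConv (g n) (weilReflect h)) with hc
  set p : ℕ → ℂ := fun n ↦ ∫ t, g n t * conj (h t) with hp
  -- real parts
  have hre : Tendsto (fun n ↦ (c n - (weilGroundEnergy a : ℂ) * p n).re) atTop (𝓝 0) := by
    refine (tendsto_re_weilCross_sub g hg hgs hg1 hQ hh hhs).congr' (Eventually.of_forall fun n ↦ ?_)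
    simp only [hc, hp, Complex.sub_re, Complex.re_ofReal_mul]
  -- imaginary parts: the direction `i h`
  have hih : IsWeilTest fun t ↦ I * h t := hh.const_mul I
  have hihs : tsupport (fun t ↦ I * h t) ⊆ Icc (-a) a := (tsupport_mul_subset_right).trans hhs
  have him : Tendsto (fun n ↦ (c n - (weilGroundEnergy a : ℂ) * p n).im) atTop (𝓝 0) := by
    refine (tendsto_re_weilCross_sub g hg hgs hg1 hQ hih hihs).congr' (Eventually.of_forall fun n ↦ ?_)
    rw [weilCross_const_mul_right, integral_mul_conj_const_mul, re_conj_I_mul, re_conj_I_mul]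
    simp only [hc, hp, Complex.sub_im, Complex.im_ofReal_mul]
  -- hence `cₙ - ε pₙ → 0` in `ℂ`
  have hdiff : Tendsto (fun n ↦ c n - (weilGroundEnergy a : ℂ) * p n) atTop (𝓝 0) := by
    refine squeeze_zero_norm (fun n ↦ Complex.norm_le_abs_re_add_abs_im _) ?_
    simpa using (hre.abs).add (him.abs)
  -- and `pₙ → ⟨u, h⟩`
  have hp_lim : Tendsto p atTop (𝓝 (∫ t, u t * conj (h t))) := by
    have h1 := tendsto_integral_mul_conj (isWeilTest_memLp hh) hu (fun m ↦ isWeilTest_memLp (hg m)) hgu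
    have h2 := (Complex.continuous_conj.tendsto _).comp h1
    rw [← integral_mul_conj_comm] at h2
    refine h2.congr (fun n ↦ ?_)
    simp only [Function.comp_apply, hp]
    rw [← integral_mul_conj_comm]
  have hsum := hdiff.add (hp_lim.const_mul (weilGroundEnergy a : ℂ))
  rw [zero_add] at hsum
  refine hsum.congr (fun n ↦ ?_)
  simp only [hc, hp]
  ring

/-! ## Ground states: weak eigenvectors; at an onset, weak null vectors -/

/-- **A ground state is a weak eigenvector of the truncated Weil form (Bombieri 2000, (4.2)).**
For `IsWeilGroundState a u` there is a normalised minimising sequence of window tests `gₙ → u` in `L²`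
(the defining data) along which `W(gₙ ⋆ h̃) → ε(a) ⟨u, h⟩` for EVERY window test `h`. [new] -/
theorem exists_seq_tendsto_weilCross_of_isWeilGroundState (hu : IsWeilGroundState a u) :
    ∃ g : ℕ → ℝ → ℂ,
      (∀ n, IsWeilTest (g n) ∧ tsupport (g n) ⊆ Icc (-a) a ∧ ∫ t, ‖g n t‖ ^ 2 = (1 : ℝ)) ∧
      Tendsto (fun n ↦ ∫ t, ‖g n t - u t‖ ^ 2) atTop (𝓝 0) ∧
      ∀ h : ℝ → ℂ, IsWeilTest h → tsupport h ⊆ Icc (-a) a →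
        Tendsto (fun n ↦ weilFunctional (weilConv (g n) (weilReflect h))) atTop
          (𝓝 ((weilGroundEnergy a : ℂ) * ∫ t, u t * conj (h t))) := by
  obtain ⟨hu2, g, hg, hQ, hgu⟩ := hu
  exact ⟨g, hg, hgu, fun h hh hhs ↦ tendsto_weilCross_of_minimizing g (fun n ↦ (hg n).1)
    (fun n ↦ (hg n).2.1) (fun n ↦ (hg n).2.2) hQ hu2 hgu hh hhs⟩

/-- **Every minimising sequence works.**  The conclusion of the previous theorem holds along ANY
normalised minimising sequence converging to `u` in `L²`, not only the defining one. [new] -/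
theorem tendsto_weilCross_of_isWeilGroundState (hu : IsWeilGroundState a u) (g : ℕ → ℝ → ℂ)
    (hg : ∀ n, IsWeilTest (g n)) (hgs : ∀ n, tsupport (g n) ⊆ Icc (-a) a)
    (hg1 : ∀ n, ∫ t, ‖g n t‖ ^ 2 = (1 : ℝ))
    (hQ : Tendsto (fun n ↦ (weilQuadratic (g n)).re) atTop (𝓝 (weilGroundEnergy a)))
    (hgu : Tendsto (fun n ↦ ∫ t, ‖g n t - u t‖ ^ 2) atTop (𝓝 0))
    (hh : IsWeilTest h) (hhs : tsupport h ⊆ Icc (-a) a) :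
    Tendsto (fun n ↦ weilFunctional (weilConv (g n) (weilReflect h))) atTop
      (𝓝 ((weilGroundEnergy a : ℂ) * ∫ t, u t * conj (h t))) :=
  tendsto_weilCross_of_minimizing g hg hgs hg1 hQ hu.1 hgu hh hhs

/-- **At an onset every ground state is a weak null vector of Weil's form on the window.**
If `IsWeilOnset a₀` (so `ε(a₀) = 0`) and `IsWeilGroundState a₀ u`, then along any normalised
minimising sequence `gₙ → u` and for every window test `h`: `W(gₙ ⋆ h̃) → 0`. [new] -/
theorem tendsto_weilCross_zero_of_onset {a₀ : ℝ} (ha₀ : IsWeilOnset a₀)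
    (hu : IsWeilGroundState a₀ u) (g : ℕ → ℝ → ℂ)
    (hg : ∀ n, IsWeilTest (g n)) (hgs : ∀ n, tsupport (g n) ⊆ Icc (-a₀) a₀)
    (hg1 : ∀ n, ∫ t, ‖g n t‖ ^ 2 = (1 : ℝ))
    (hQ : Tendsto (fun n ↦ (weilQuadratic (g n)).re) atTop (𝓝 (weilGroundEnergy a₀)))
    (hgu : Tendsto (fun n ↦ ∫ t, ‖g n t - u t‖ ^ 2) atTop (𝓝 0))
    (hh : IsWeilTest h) (hhs : tsupport h ⊆ Icc (-a₀) a₀) :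
    Tendsto (fun n ↦ weilFunctional (weilConv (g n) (weilReflect h))) atTop (𝓝 0) := by
  have := tendsto_weilCross_of_isWeilGroundState hu g hg hgs hg1 hQ hgu hh hhs
  rwa [ha₀.eq_zero, Complex.ofReal_zero, zero_mul] at this

/-- **Criterion.**  If ground states exist on every window `a ≥ log 3 / 2` (Bombieri 2000, Thm. 3 —
an explicit hypothesis here) and NO ground state of such a window is a weak null vector — i.e. for every
ground state `u` some normalised minimising sequence `gₙ → u` and some window test `h` have
`W(gₙ ⋆ h̃) ↛ 0` — then the Riemann hypothesis holds: otherwise `ε` has an onset `a₀ ≥ log 3 / 2`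
(`exists_isWeilOnset_of_not_riemannHypothesis`, `IsWeilOnset.log_three_half_le`), where every ground
state is weakly null along every minimising sequence (`tendsto_weilCross_zero_of_onset`). [new] -/
theorem riemannHypothesis_of_groundStates_not_null
    (hex : ∀ a : ℝ, Real.log 3 / 2 ≤ a → ∃ u : ℝ → ℂ, IsWeilGroundState a u)
    (hnn : ∀ a : ℝ, Real.log 3 / 2 ≤ a → ∀ u : ℝ → ℂ, IsWeilGroundState a u →
      ∃ g : ℕ → ℝ → ℂ, ∃ h : ℝ → ℂ,
        (∀ n, IsWeilTest (g n) ∧ tsupport (g n) ⊆ Icc (-a) a ∧ ∫ t, ‖g n t‖ ^ 2 = (1 : ℝ)) ∧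
        Tendsto (fun n ↦ (weilQuadratic (g n)).re) atTop (𝓝 (weilGroundEnergy a)) ∧
        Tendsto (fun n ↦ ∫ t, ‖g n t - u t‖ ^ 2) atTop (𝓝 0) ∧
        IsWeilTest h ∧ tsupport h ⊆ Icc (-a) a ∧
        ¬ Tendsto (fun n ↦ weilFunctional (weilConv (g n) (weilReflect h))) atTop (𝓝 0)) :
    RiemannHypothesis := by
  by_contra hRH
  obtain ⟨a₀, ha₀⟩ := exists_isWeilOnset_of_not_riemannHypothesis hRH
  have hl : Real.log 3 / 2 ≤ a₀ := ha₀.log_three_half_le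
  obtain ⟨u, hu⟩ := hex a₀ hl
  obtain ⟨g, h, hg, hQ, hgu, hh, hhs, hnot⟩ := hnn a₀ hl u hu
  exact hnot (tendsto_weilCross_zero_of_onset ha₀ hu g (fun n ↦ (hg n).1) (fun n ↦ (hg n).2.1)
    (fun n ↦ (hg n).2.2) hQ hgu hh hhs)

/-- The same criterion with existence of ground states supplied by the compactness fact
`ConnesConsaniMoscovici2025_thm_3_6` (CCM25 Thm. 3.6, a named Literature claim; its proved consequence
`ConnesConsaniMoscovici2025_thm_3_6.exists_isWeilGroundState` gives a ground state on every window). [new] -/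
theorem riemannHypothesis_of_ccm36_of_groundStates_not_null (h36 : ConnesConsaniMoscovici2025_thm_3_6)
    (hnn : ∀ a : ℝ, Real.log 3 / 2 ≤ a → ∀ u : ℝ → ℂ, IsWeilGroundState a u →
      ∃ g : ℕ → ℝ → ℂ, ∃ h : ℝ → ℂ,
        (∀ n, IsWeilTest (g n) ∧ tsupport (g n) ⊆ Icc (-a) a ∧ ∫ t, ‖g n t‖ ^ 2 = (1 : ℝ)) ∧
        Tendsto (fun n ↦ (weilQuadratic (g n)).re) atTop (𝓝 (weilGroundEnergy a)) ∧
        Tendsto (fun n ↦ ∫ t, ‖g n t - u t‖ ^ 2) atTop (𝓝 0) ∧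
        IsWeilTest h ∧ tsupport h ⊆ Icc (-a) a ∧
        ¬ Tendsto (fun n ↦ weilFunctional (weilConv (g n) (weilReflect h))) atTop (𝓝 0)) :
    RiemannHypothesis :=
  riemannHypothesis_of_groundStates_not_null
    (fun a ha ↦ h36.exists_isWeilGroundState
      ((div_pos (Real.log_pos (by norm_num)) two_pos).trans_le ha)) hnn

/-- Summit form of the criterion. [new] -/
theorem summit_of_groundStates_not_null
    (hex : ∀ a : ℝ, Real.log 3 / 2 ≤ a → ∃ u : ℝ → ℂ, IsWeilGroundState a u)
    (hnn : ∀ a : ℝ, Real.log 3 / 2 ≤ a → ∀ u : ℝ → ℂ, IsWeilGroundState a u →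
      ∃ g : ℕ → ℝ → ℂ, ∃ h : ℝ → ℂ,
        (∀ n, IsWeilTest (g n) ∧ tsupport (g n) ⊆ Icc (-a) a ∧ ∫ t, ‖g n t‖ ^ 2 = (1 : ℝ)) ∧
        Tendsto (fun n ↦ (weilQuadratic (g n)).re) atTop (𝓝 (weilGroundEnergy a)) ∧
        Tendsto (fun n ↦ ∫ t, ‖g n t - u t‖ ^ 2) atTop (𝓝 0) ∧
        IsWeilTest h ∧ tsupport h ⊆ Icc (-a) a ∧
        ¬ Tendsto (fun n ↦ weilFunctional (weilConv (g n) (weilReflect h))) atTop (𝓝 0)) :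
    Summit.RiemannHypothesis :=
  riemannHypothesis_of_groundStates_not_null hex hnn

end Summit.RiemannHypothesis.RiemannHypothesis.Theorems
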